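import Summits.ValiantsHypothesis.ValiantsHypothesis.Theses.GrenetZeon
import Literature.Computability.AlgebraicComplexity.LayeredABPScalarRestriction
import Literature.Computability.AlgebraicComplexity.AndrewsForbes2022Cor39Proofs
import Literature.Computability.AlgebraicComplexity.DeterminantalComplexityProofs
import Literature.Computability.AlgebraicComplexity.StandardFamiliesProofs
import HarnessLib

/-!
# Route GrenetZeon — transfer to ordinary determinantal complexity (item stmt-ValiantsHypothesis-8069)

`TransferToDc`: an `(m, s)`-representation of `per_n` — an `m × m` matrix `A` of affine forms with
coefficients in a commutative `ℂ`-algebra `R` of dimension `≤ s`, whose determinant read through a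
`ℂ`-linear functional `λ : R → ℂ` is `per_n` coefficientwise — gives an ordinary affine determinantal
representation of `per_n` of size `(s + 1)(m + 1)³` (monotonicity of the route's two-parameter model
with respect to ordinary `dc`).

Proof (the item's plan, on the tree's layered-ABP toolkit):
1. `det_m` over `ℂ` is computed by a layered algebraic branching program on `(m³ − m)/3 + 2 ≤ m³ + 2`
   vertices — Ikenmeyer–Landsberg's pruned Mahajan–Vinay program, in tree as
   `Corollary39.layeredABPComputes_detPoly_add_two` (`AndrewsForbes2022Cor39Proofs.lean`) with the
   count `IL17.card_vtx`; base change along `algebraMap ℂ R` (`LayeredABPComputes.map`) gives the same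
   program for `det_m` over `R` (`layeredABPComputes_detPoly_of_algebra`).
2. Substituting the affine entries of `A` keeps a layered program on `≤ m³ + 2` vertices computing
   `det A ∈ R[x]` (`LayeredABPComputes.aeval_affine`).
3. Regular-representation unrolling along a `ℂ`-basis of `R` (`LayeredABPComputes.restrictScalars`,
   `LayeredABPScalarRestriction.lean`; Hrubeš–Yehudayoff accounting): a layered program on
   `≤ (m³ + 2) · dim R + 2` vertices over `ℂ` computes `λ(det A) = per_n`.
4. A layered program on `M` vertices is an affine determinant of size `M + 1`
   (`LayeredABPComputes.hasDetRepr`, Valiant / IL17 Thm. 4.1), and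
   `(m³ + 2) s + 3 ≤ (s + 1)(m + 1)³`; pad with `HasDetRepr.mono_holds`. The degenerate size `m = 0`
   (`det A = 1`, `per_n` constant) is the `1 × 1` determinant `(λ(1))`.

* `transferToDc_proof : TransferToDc` — the item, verbatim.

Honest framing: bookkeeping inside route GrenetZeon's two-parameter model (with `DiagonalBound` and
Mignon–Ressayre it shows the model is consistent with known bounds); no statement about VP ≠ VNP is
proved and nothing here is progress on it.

## References

* M. Mahajan, V. Vinay, *Determinant: combinatorics, algorithms, and complexity*, Chicago J.
  Theoret. Comput. Sci. 1997, §3 (the layered determinant program). [MahajanVinay1997]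
* C. Ikenmeyer, J. M. Landsberg, *On the complexity of the permanent in various computational
  models*, J. Pure Appl. Algebra 221 (2017), Prop. 3.2 / Thm. 4.1. [IkenmeyerLandsberg2017]
* P. Hrubeš, A. Yehudayoff, *Arithmetic complexity in ring extensions*, Theory of Computing 7
  (2011), Thm. 1.1, §4. [HrubesYehudayoff2011]
* L. G. Valiant, *Completeness classes in algebra*, STOC 1979, §2. [Valiant1979]
-/

set_option linter.dupNamespace false

noncomputable section

namespace Summit.ValiantsHypothesis.ValiantsHypothesis.Theorems.GrenetZeon

open MvPolynomial Literature.Computability.AlgebraicComplexity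
open Summit.ValiantsHypothesis.ValiantsHypothesis.Theses.GrenetZeon

/-- `det_m` (`m ≥ 1`) over a field is computed by a layered ABP on at most `m³ + 2` vertices: IL17's
pruned Mahajan–Vinay program has `(m³ − m)/3 + 2` vertices with source and sink (`m ≥ 2`), and
`det_1 = X₀₀` is a single edge. [cite: IkenmeyerLandsberg2017, Prop. 3.2] -/
theorem layeredABPComputes_detPoly_cube (F : Type) [Field F] (m : ℕ) (hm : 1 ≤ m) :
    LayeredABPComputes (m ^ 3 + 2) (detPoly (Fin m) F) := by
  rcases m with _ | m
  · omega
  rcases m with _ | n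
  · -- `det_1 = X₀₀`
    have h1 : detPoly (Fin 1) F = X ((0 : Fin 1), (0 : Fin 1)) := by
      rw [detPoly, Matrix.det_unique]; rfl
    rw [h1]
    exact layeredABPComputes_X _ (by norm_num)
  · refine (Corollary39.layeredABPComputes_detPoly_add_two (k := F) (n := n)).mono ?_
    rw [IL17.card_vtx]
    have hx : (n + 1 + 1) ^ 3 = (n + 2) ^ 3 := rfl
    rw [hx]
    exact Nat.add_le_add_right ((Nat.div_le_self _ _).trans (Nat.sub_le _ _)) 2

/-- Base change of the generic determinant: `det_m` over `F` maps to `det_m` over any `F`-algebra `R`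
coefficientwise. [folklore] -/
theorem map_detPoly (F R : Type) [CommRing F] [CommRing R] (f : F →+* R) (m : ℕ) :
    MvPolynomial.map f (detPoly (Fin m) F) = detPoly (Fin m) R := by
  rw [detPoly, detPoly, RingHom.map_det, RingHom.mapMatrix_apply]
  congr 1
  ext i j
  simp [Matrix.mvPolynomialX, Matrix.map_apply, map_X]

/-- `det_m` (`m ≥ 1`) over any commutative algebra `R` over a field `F` is computed by a layered ABP
on at most `m³ + 2` vertices (base change of the program over `F` along `algebraMap F R`; the
Mahajan–Vinay program is division-free, so nothing about `R` is used).
[cite: MahajanVinay1997, §3] -/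
theorem layeredABPComputes_detPoly_of_algebra (F R : Type) [Field F] [CommRing R] [Algebra F R]
    (m : ℕ) (hm : 1 ≤ m) : LayeredABPComputes (m ^ 3 + 2) (detPoly (Fin m) R) := by
  have h := (layeredABPComputes_detPoly_cube F m hm).map (algebraMap F R)
  rwa [map_detPoly] at h

/-- The size bookkeeping: `(m³ + 2) r + 3 ≤ (s + 1)(m + 1)³` for `r ≤ s` and `m ≥ 1`. [folklore] -/
theorem size_bound (m r s : ℕ) (hm : 1 ≤ m) (hr : r ≤ s) :
    (m ^ 3 + 2) * r + 2 + 1 ≤ (s + 1) * (m + 1) ^ 3 := by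
  have h1 : (m + 1) ^ 3 = m ^ 3 + 3 * m ^ 2 + 3 * m + 1 := by ring
  have h2 : 1 ≤ m ^ 2 := Nat.one_le_pow _ _ hm
  have h3 : (m ^ 3 + 2) * r ≤ (m ^ 3 + 2) * s := Nat.mul_le_mul_left _ hr
  have h4 : s * 1 ≤ s * m ^ 2 := Nat.mul_le_mul_left _ h2
  rw [h1]
  nlinarith [h2, h3, h4]

/-- **Item `TransferToDc` (stmt-ValiantsHypothesis-8069).** An `(m, s)`-representation of `per_n`
over a finite-dimensional commutative `ℂ`-algebra gives `dc(per_n) ≤ (s + 1)(m + 1)³`: Mahajan–Vinay's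
division-free layered determinant program over `R`, affine substitution, regular-representation
unrolling with the linear read-out `λ`, and the closure of a layered program into one affine
determinant. [cite: IkenmeyerLandsberg2017, Thm. 4.1] -/
theorem transferToDc_proof : TransferToDc := by
  intro n m s hrep
  obtain ⟨R, _, _, _, hR, l, A, hA, hf⟩ := hrep
  rcases Nat.eq_zero_or_pos m with rfl | hm
  · -- `m = 0`: `det A = 1`, so `per_n = λ(1)` is a constant: a `1 × 1` determinant
    have hdet : A.det = 1 := Matrix.det_isEmpty
    have hper : perPoly (Fin n) ℂ = C (l 1) := by
      classical
      refine MvPolynomial.ext _ _ fun d => ?_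
      rw [← hf d, hdet, coeff_C, coeff_one]
      split_ifs
      · rfl
      · rw [map_zero]
    have h1 : HasDetRepr (perPoly (Fin n) ℂ) 1 := by
      refine ⟨Matrix.of fun _ _ => C (l 1), fun i j => ?_, ?_⟩
      · rw [Matrix.of_apply, totalDegree_C]; exact Nat.zero_le _
      · rw [Matrix.det_fin_one, Matrix.of_apply, hper]
    exact HasDetRepr.mono_holds h1 (by nlinarith)
  · -- `m ≥ 1`
    -- a `ℂ`-basis of `R`
    let b := Module.finBasis ℂ R
    -- Mahajan–Vinay over `R`, with the affine entries of `A` substituted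
    have hdetA : LayeredABPComputes (m ^ 3 + 2) A.det := by
      have h := (layeredABPComputes_detPoly_of_algebra ℂ R m hm).aeval_affine
        (fun p : Fin m × Fin m => A p.1 p.2) (fun p => hA p.1 p.2)
      rwa [detPoly, AlgHom.map_det, Matrix.mvPolynomialX_mapMatrix_aeval] at h
    -- regular-representation unrolling, read through `λ`
    have hQ := hdetA.restrictScalars b l
    have hper : (AddMonoidAlgebra.map l.toAddMonoidHom A.det : MvPolynomial (Fin n × Fin n) ℂ) =
        perPoly (Fin n) ℂ :=
      MvPolynomial.ext _ _ fun d => hf d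
    rw [hper, Fintype.card_fin] at hQ
    -- close the program into a determinant and pad
    exact HasDetRepr.mono_holds hQ.hasDetRepr (size_bound m _ s hm hR)

end Summit.ValiantsHypothesis.ValiantsHypothesis.Theorems.GrenetZeon
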